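import Mathlib
import HarnessLib
import Summits.ValiantsHypothesis.ValiantsHypothesis.Theses.PermanentalCones
import Summits.ValiantsHypothesis.ValiantsHypothesis.Theorems.PermanentalConesDetToVP
import Summits.ValiantsHypothesis.ValiantsHypothesis.Theorems.PermanentalConesHyperbolicVPShadowStubLinearRealSpectrumNormalForm
import Summits.ValiantsHypothesis.ValiantsHypothesis.Theorems.PermanentalConesHyperbolicVPShadowBridges
import Summits.ValiantsHypothesis.ValiantsHypothesis.Theorems.PermanentalConesHyperbolicVPShadowIsVPFamilyDetAffine
import Literature.Computability.AlgebraicComplexity.DeterminantalComplexity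

/-!
# ValiantsHypothesis / PermanentalCones — the family form HT implies the pencil form:
# `HyperbolicVPShadow → HyperbolicDetShadow`

Lead c1, line `birth` of crux `HyperbolicVPShadow` (item `stmt-ValiantsHypothesis-8655`).
With the proved `DetToVP : HyperbolicDetShadow → HyperbolicVPShadow` (item 8657) this makes crux #5
(HT, family form) and crux #3 (`HyperbolicDetShadow`, item `stmt-ValiantsHypothesis-8653`, pencil
form) of route `PermanentalCones` EQUIVALENT, and both equivalent to stub B of line `birth`.

Proof (diagonal argument). Suppose `HyperbolicDetShadow` fails. By the landed stub A and bridge 2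
(`permanentalCones_realSpectrumShadow_iff_hyperbolicDetShadow`), stub B fails: for every `c` there
is a real-spectrum LINEAR pencil `P_c` (size `N_c`, `n_c` variables) whose closed "nonnegative
spectrum" cone has no lifted-LMI description of size `≤ 2^((log₂ N_c + c)^c)`.
* (`permanentalCones_linearPencil_reduce`) WLOG `n_c ≤ N_c²`: `P_c` factors as `P'_c ∘ T` with
  `T` linear surjective onto `ℝ^r`, `r = dim range P_c ≤ N_c²`; `P'_c` has real spectrum and its
  cone pulls back to the cone of `P_c`, so hardness transfers.
* (`permanentalCones_slackPencil_spec`, the construction of bridge 1) the slack pencil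
  `Σ u_i P'(δ_i) + t·1` in `r + 1` variables is a linear determinantal representation of a form `F_c`
  of degree `N_c`, hyperbolic w.r.t. `δ_last`, whose cone has the cone of `P'_c` as the section
  `t = 0`; hardness transfers again. So we have HDS-witnesses with `≤ N_c² + 1` variables.
* Select, for every index `k`, the constant `sel k ≤ k` with `N_{sel k} ≤ k` maximising the
  hardness exponent `H c = (log₂ N_c + c)^c` (or `0` if none qualifies); the family is
  `k ↦ F_{sel k}`, in `r_{sel k} + 1 ≤ (k + N_0)² + 1` variables, of pencil size `N_{sel k} ≤ k + N_0`.
* (sub-goal V, `permanentalCones_isVPFamily_det_affine`, LANDED p144875 in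
  `Theorems/PermanentalConesHyperbolicVPShadowIsVPFamilyDetAffine.lean`) determinants of affine real
  pencils of p-bounded size in p-bounded many variables form a `VP_ℂ` family; so the family is a
  `VP_ℂ` family of homogeneous hyperbolic forms and HT applies: some `c'` bounds the description
  size at index `k` by `2^((log₂ k + c')^{c'})`.
* Put `c₀ = 2c' + 1`, `k₀ = max c₀ N_{c₀}`: `c₀` qualifies at `k₀`, so
  `H (sel k₀) ≥ H c₀ = (log₂ N_{c₀} + c₀)^{c₀} ≥ (log₂ k₀ + c')^{c'}` (`permanentalCones_diag_arith`,
  two cases of the `max`, using `log₂ (2c'+1) ≤ c' + 1`) — contradicting the hardness at `sel k₀`.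
-/

-- `<Problem> = <Summit>` for this single-conjunct summit (lakefile sets the same option tree-wide).
set_option linter.dupNamespace false

namespace Summit.ValiantsHypothesis.ValiantsHypothesis.Theorems

open MvPolynomial Literature.Computability.AlgebraicComplexity
open Summit.ValiantsHypothesis.ValiantsHypothesis.Theses.PermanentalCones

/-! ### Linear-algebraic reduction of the number of variables of a linear pencil -/

/-- **Variable reduction.** A linear pencil `P : ℝ^n → Mat_N(ℝ)` factors as `P = P' ∘ T` through a
linear surjection `T : ℝ^n → ℝ^r` with `r ≤ N²` (coordinates w.r.t. a basis of `range P`).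
[folklore] -/
theorem permanentalCones_linearPencil_reduce {n N : ℕ}
    (P : (Fin n → ℝ) →ₗ[ℝ] Matrix (Fin N) (Fin N) ℝ) :
    ∃ r : ℕ, r ≤ N * N ∧ ∃ (P' : (Fin r → ℝ) →ₗ[ℝ] Matrix (Fin N) (Fin N) ℝ)
      (T : (Fin n → ℝ) →ₗ[ℝ] (Fin r → ℝ)), Function.Surjective T ∧ ∀ x, P' (T x) = P x := by
  set W : Submodule ℝ (Matrix (Fin N) (Fin N) ℝ) := LinearMap.range P with hW
  set b := Module.finBasis ℝ W
  refine ⟨Module.finrank ℝ W, ?_, W.subtype ∘ₗ (b.equivFun.symm : (Fin _ → ℝ) →ₗ[ℝ] W),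
    (b.equivFun : W →ₗ[ℝ] (Fin _ → ℝ)) ∘ₗ P.rangeRestrict, ?_, fun x => ?_⟩
  · calc Module.finrank ℝ W ≤ Module.finrank ℝ (Matrix (Fin N) (Fin N) ℝ) := Submodule.finrank_le W
      _ = N * N := by simp [Module.finrank_matrix]
  · exact b.equivFun.surjective.comp (LinearMap.surjective_rangeRestrict P)
  · simp

/-! ### The slack pencil of a real-spectrum linear pencil (the construction of bridge 1) -/

/-- **Slack pencil.** For a linear pencil `P : ℝ^r → Mat_N(ℝ)` all of whose values have only real
eigenvalues, the pencil `Σ_{i<r} u_i P(δ_i) + u_r · 1` in `r + 1` variables is an affine (linear)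
determinantal representation of a form `F` (of degree `N`) hyperbolic w.r.t. `δ_r`, and the closed
"nonnegative spectrum" cone of `P` is the preimage of the closed hyperbolicity cone of `F` under the
linear map `u ↦ (u, 0)`. [folklore] -/
theorem permanentalCones_slackPencil_spec {r N : ℕ} (P : (Fin r → ℝ) →ₗ[ℝ] Matrix (Fin N) (Fin N) ℝ)
    (hP : ∀ (x : Fin r → ℝ) (z : ℂ),
      ((P x).map (algebraMap ℝ ℂ) - z • (1 : Matrix (Fin N) (Fin N) ℂ)).det = 0 → z.im = 0) :
    ∃ (F : MvPolynomial (Fin (r + 1)) ℝ) (M : Matrix (Fin N) (Fin N) (MvPolynomial (Fin (r + 1)) ℝ))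
      (e : Fin (r + 1) → ℝ) (S : (Fin r → ℝ) →ₗ[ℝ] (Fin (r + 1) → ℝ)),
      IsAffineDetRepr F M ∧ (∃ d : ℕ, F.IsHomogeneous d) ∧
      (MvPolynomial.eval e F ≠ 0 ∧ ∀ (x : Fin (r + 1) → ℝ) (z : ℂ),
        MvPolynomial.eval (fun j => (x j : ℂ) + z * (e j : ℂ))
          (MvPolynomial.map (algebraMap ℝ ℂ) F) = 0 → z.im = 0) ∧
      ∀ u : Fin r → ℝ, (∀ τ : ℝ, 0 < τ → (P u + τ • (1 : Matrix (Fin N) (Fin N) ℝ)).det ≠ 0) ↔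
        ∀ τ : ℝ, 0 < τ → MvPolynomial.eval (S u + τ • e) F ≠ 0 := by
  -- the slack pencil `M = Σ_j X_j • Q_j`, `Q = (P(δ_0), …, P(δ_{r-1}), 1)`, direction `e = δ_r`
  set Q : Fin (r + 1) → Matrix (Fin N) (Fin N) ℝ :=
    @Fin.snoc r (fun _ => Matrix (Fin N) (Fin N) ℝ) (fun j => P (Pi.single j 1)) 1 with hQ
  set M : Matrix (Fin N) (Fin N) (MvPolynomial (Fin (r + 1)) ℝ) :=
    Matrix.of fun i l => ∑ j, C (Q j i l) * X j with hM
  set e : Fin (r + 1) → ℝ := Pi.single (Fin.last r) 1 with he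
  let S : (Fin r → ℝ) →ₗ[ℝ] (Fin (r + 1) → ℝ) :=
    LinearMap.pi (@Fin.snoc r (fun _ => (Fin r → ℝ) →ₗ[ℝ] ℝ) (fun j => LinearMap.proj j) 0)
  have heval : ∀ x' : Fin (r + 1) → ℝ, eval x' M.det =
      (P (fun j => x' (Fin.castSucc j)) + x' (Fin.last r) • (1 : Matrix (Fin N) (Fin N) ℝ)).det := by
    intro x'
    rw [← permanentalCones_det_map_ringHom (eval x') M, hM, permanentalCones_linearPencil_map_eval,
      hQ, permanentalCones_sum_smul_slackCoeff]
  have hevalC : ∀ (x' : Fin (r + 1) → ℝ) (z : ℂ),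
      eval (fun j => (x' j : ℂ) + z * (e j : ℂ)) (MvPolynomial.map (algebraMap ℝ ℂ) M.det) =
        ((P (fun j => x' (Fin.castSucc j))).map (algebraMap ℝ ℂ) +
          ((x' (Fin.last r) : ℂ) + z) • (1 : Matrix (Fin N) (Fin N) ℂ)).det := by
    intro x' z
    rw [← permanentalCones_det_map_ringHom (MvPolynomial.map (algebraMap ℝ ℂ)) M,
      ← permanentalCones_det_map_ringHom (eval fun j => (x' j : ℂ) + z * (e j : ℂ)), hM,
      permanentalCones_linearPencil_map_map_eval, hQ, he, permanentalCones_sum_smul_slackCoeff_complex]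
  have hS1 : ∀ (x : Fin r → ℝ) (τ : ℝ) (j : Fin r), (S x + τ • e) (Fin.castSucc j) = x j := by
    intro x τ j
    simp [S, he, LinearMap.pi_apply, Fin.snoc_castSucc, Fin.castSucc_ne_last]
  have hS2 : ∀ (x : Fin r → ℝ) (τ : ℝ), (S x + τ • e) (Fin.last r) = τ := by
    intro x τ
    simp [S, he, LinearMap.pi_apply, Fin.snoc_last]
  refine ⟨M.det, M, e, S, ⟨fun i l => permanentalCones_totalDegree_sum_C_mul_X_le _, rfl⟩,
    ⟨N, permanentalCones_isHomogeneous_det_of_linear M fun i l =>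
      permanentalCones_isHomogeneous_sum_C_mul_X _⟩, ⟨?_, fun x' z hz => ?_⟩, fun u => ?_⟩
  · have h0 : (fun j : Fin r => e (Fin.castSucc j)) = 0 := by
      funext j
      simp [he, Fin.castSucc_ne_last]
    rw [heval, h0, map_zero, zero_add, he]
    simp
  · rw [hevalC] at hz
    have him := hP (fun j => x' (Fin.castSucc j)) (-((x' (Fin.last r) : ℂ) + z))
      (by rwa [neg_smul, sub_neg_eq_add])
    simpa using him
  · refine forall_congr' fun τ => imp_congr_right fun _ => ?_
    rw [heval]
    simp only [hS1, hS2]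

/-! ### The arithmetic of the diagonal -/

/-- With `c₀ = 2c' + 1` and `k₀ = max c₀ X`: `(log₂ k₀ + c')^{c'} ≤ (log₂ X + c₀)^{c₀}`.
[folklore] -/
theorem permanentalCones_diag_arith (c' X : ℕ) :
    (Nat.log 2 (max (2 * c' + 1) X) + c') ^ c' ≤ (Nat.log 2 X + (2 * c' + 1)) ^ (2 * c' + 1) := by
  have hlog : Nat.log 2 (2 * c' + 1) ≤ c' + 1 := by
    have h : 2 * c' + 1 < 2 ^ (c' + 1) := by
      have := Nat.lt_two_pow_self (n := c')
      rw [pow_succ]; omega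
    exact Nat.le_of_lt_succ ((Nat.log_lt_iff_lt_pow (by norm_num) (by omega)).2
      (h.trans_le (Nat.pow_le_pow_right (by norm_num) (Nat.le_succ _))))
  rcases le_total (2 * c' + 1) X with hX | hX
  · rw [max_eq_right hX]
    calc (Nat.log 2 X + c') ^ c' ≤ (Nat.log 2 X + (2 * c' + 1)) ^ c' :=
          Nat.pow_le_pow_left (by omega) _
      _ ≤ (Nat.log 2 X + (2 * c' + 1)) ^ (2 * c' + 1) :=
          Nat.pow_le_pow_right (by omega) (by omega)
  · rw [max_eq_left hX]
    calc (Nat.log 2 (2 * c' + 1) + c') ^ c' ≤ (2 * c' + 1) ^ c' :=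
          Nat.pow_le_pow_left (by omega) _
      _ ≤ (2 * c' + 1) ^ (2 * c' + 1) := Nat.pow_le_pow_right (by omega) (by omega)
      _ ≤ (Nat.log 2 X + (2 * c' + 1)) ^ (2 * c' + 1) := Nat.pow_le_pow_left (by omega) _

/-! ### The diagonal argument -/

/-- **HT (family form) implies the pencil form.** `HyperbolicVPShadow → HyperbolicDetShadow`
(items `stmt-ValiantsHypothesis-8655` ⇒ `stmt-ValiantsHypothesis-8653`), by the diagonal argument of
the module docstring; with the proved `DetToVP` the two cruxes are equivalent. [folklore] -/
theorem permanentalCones_hyperbolicDetShadow_of_hyperbolicVPShadow :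
    Summit.ValiantsHypothesis.ValiantsHypothesis.Theses.PermanentalCones.HyperbolicVPShadow →
      Summit.ValiantsHypothesis.ValiantsHypothesis.Theses.PermanentalCones.HyperbolicDetShadow := by
  intro hVS
  by_contra hDS
  -- Step 1: stub B fails (bridge 2 with the landed stub A): hard real-spectrum linear pencils
  have hB := mt (permanentalCones_realSpectrumShadow_iff_hyperbolicDetShadow
    stub_linearRealSpectrumNormalForm).1 hDS
  have hW : ∀ c : ℕ, ∃ (n N : ℕ) (P : (Fin n → ℝ) →ₗ[ℝ] Matrix (Fin N) (Fin N) ℝ),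
      (∀ (x : Fin n → ℝ) (z : ℂ),
        ((P x).map (algebraMap ℝ ℂ) - z • (1 : Matrix (Fin N) (Fin N) ℂ)).det = 0 → z.im = 0) ∧
      ¬ ∃ m ≤ 2 ^ ((Nat.log 2 N + c) ^ c),
        ∃ (p : ℕ) (A : (Fin n → ℝ) × (Fin p → ℝ) →ₗ[ℝ] Matrix (Fin m) (Fin m) ℝ)
          (B : Matrix (Fin m) (Fin m) ℝ), ∀ x : Fin n → ℝ,
          (∀ τ : ℝ, 0 < τ → (P x + τ • (1 : Matrix (Fin N) (Fin N) ℝ)).det ≠ 0) ↔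
            ∃ y : Fin p → ℝ, (A (x, y) + B).PosSemidef := by
    intro c
    by_contra hc
    refine hB ⟨c, fun n N P hP => ?_⟩
    by_contra hrep
    exact hc ⟨n, N, P, hP, hrep⟩
  -- Step 2: reduce variables (`n ≤ N²`) and pass to the slack pencil: hard HDS-witnesses
  have hW' : ∀ c : ℕ, ∃ (r N : ℕ) (F : MvPolynomial (Fin (r + 1)) ℝ)
      (M : Matrix (Fin N) (Fin N) (MvPolynomial (Fin (r + 1)) ℝ)) (e : Fin (r + 1) → ℝ),
      r ≤ N * N ∧ IsAffineDetRepr F M ∧ (∃ d : ℕ, F.IsHomogeneous d) ∧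
      (MvPolynomial.eval e F ≠ 0 ∧ ∀ (x : Fin (r + 1) → ℝ) (z : ℂ),
        MvPolynomial.eval (fun j => (x j : ℂ) + z * (e j : ℂ))
          (MvPolynomial.map (algebraMap ℝ ℂ) F) = 0 → z.im = 0) ∧
      ∀ m ≤ 2 ^ ((Nat.log 2 N + c) ^ c),
        ∀ (p : ℕ) (A : (Fin (r + 1) → ℝ) × (Fin p → ℝ) →ₗ[ℝ] Matrix (Fin m) (Fin m) ℝ)
          (B : Matrix (Fin m) (Fin m) ℝ), ¬ ∀ x : Fin (r + 1) → ℝ,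
          (∀ τ : ℝ, 0 < τ → MvPolynomial.eval (x + τ • e) F ≠ 0) ↔
            ∃ y : Fin p → ℝ, (A (x, y) + B).PosSemidef := by
    intro c
    obtain ⟨n, N, P, hP, hhard⟩ := hW c
    obtain ⟨r, hr, P', T, hT, hPT⟩ := permanentalCones_linearPencil_reduce P
    have hP' : ∀ (u : Fin r → ℝ) (z : ℂ),
        ((P' u).map (algebraMap ℝ ℂ) - z • (1 : Matrix (Fin N) (Fin N) ℂ)).det = 0 → z.im = 0 := by
      intro u z hz
      obtain ⟨x, rfl⟩ := hT u
      rw [hPT] at hz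
      exact hP x z hz
    obtain ⟨F, M, e, S, hIAR, hhom, hhyp, hcone⟩ := permanentalCones_slackPencil_spec P' hP'
    refine ⟨r, N, F, M, e, hr, hIAR, hhom, hhyp, fun m hm p A B hrep => hhard ⟨m, hm, p,
      A ∘ₗ ((S ∘ₗ T).prodMap LinearMap.id), B, fun x => ?_⟩⟩
    rw [← hPT x]
    refine (hcone (T x)).trans ?_
    simpa only [LinearMap.comp_apply, LinearMap.prodMap_apply, LinearMap.id_apply] using
      hrep (S (T x))
  choose r N F M e hr hIAR hhom hhyp hhard using hW'
  -- Step 3: the selection `sel k` maximising the hardness exponent among qualifying constants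
  set H : ℕ → ℕ := fun c => (Nat.log 2 (N c) + c) ^ c with hH
  have hsel : ∀ k : ℕ, ∃ s : ℕ, N s ≤ k + N 0 ∧ ∀ c, c ≤ k → N c ≤ k → H c ≤ H s := by
    intro k
    classical
    set Q : Finset ℕ := (Finset.range (k + 1)).filter fun c => N c ≤ k with hQ
    by_cases hne : Q.Nonempty
    · obtain ⟨s, hs, hmax⟩ := Finset.exists_max_image Q H hne
      have hsQ : N s ≤ k := (Finset.mem_filter.1 hs).2
      refine ⟨s, by omega, fun c hc hNc => hmax c ?_⟩
      exact Finset.mem_filter.2 ⟨Finset.mem_range.2 (Nat.lt_succ_of_le hc), hNc⟩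
    · refine ⟨0, by omega, fun c hc hNc => ?_⟩
      exact absurd ⟨c, Finset.mem_filter.2 ⟨Finset.mem_range.2 (Nat.lt_succ_of_le hc), hNc⟩⟩ hne
  choose sel hselN hselmax using hsel
  -- Step 4: the diagonal family is a VP family of homogeneous hyperbolic forms (sub-goal V)
  have hNb : IsPBounded fun k => N (sel k) := by
    refine (IsPBounded.iff_exists_le_mul_succ_pow _).2 ⟨N 0 + 1, 1, fun k => ?_⟩
    show N (sel k) ≤ (N 0 + 1) * (k + 1) ^ 1
    have h1 := hselN k
    nlinarith
  have hrb : IsPBounded fun k => r (sel k) + 1 := by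
    refine (IsPBounded.iff_exists_le_mul_succ_pow _).2 ⟨(N 0 + 1) ^ 2 + 1, 2, fun k => ?_⟩
    show r (sel k) + 1 ≤ ((N 0 + 1) ^ 2 + 1) * (k + 1) ^ 2
    have h2 : N (sel k) ≤ (k + 1) * (N 0 + 1) := by
      have h1 := hselN k
      nlinarith
    have h3 : 1 ≤ (k + 1) ^ 2 := Nat.one_le_pow _ _ (Nat.succ_pos k)
    calc r (sel k) + 1 ≤ N (sel k) * N (sel k) + 1 := Nat.add_le_add_right (hr (sel k)) 1
      _ ≤ ((k + 1) * (N 0 + 1)) * ((k + 1) * (N 0 + 1)) + 1 :=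
          Nat.add_le_add_right (Nat.mul_le_mul h2 h2) 1
      _ = (N 0 + 1) ^ 2 * (k + 1) ^ 2 + 1 := by ring
      _ ≤ (N 0 + 1) ^ 2 * (k + 1) ^ 2 + (k + 1) ^ 2 := Nat.add_le_add_left h3 _
      _ = ((N 0 + 1) ^ 2 + 1) * (k + 1) ^ 2 := by ring
  have hVP : IsVPFamily (σ := fun k => Fin (r (sel k) + 1))
      (fun k => MvPolynomial.map (algebraMap ℝ ℂ) (F (sel k))) := by
    have hfun : (fun k => MvPolynomial.map (algebraMap ℝ ℂ) (F (sel k))) =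
        fun k => MvPolynomial.map (algebraMap ℝ ℂ) (M (sel k)).det :=
      funext fun k => by rw [(hIAR (sel k)).2]
    rw [hfun]
    exact permanentalCones_isVPFamily_det_affine (fun k => r (sel k) + 1) (fun k => N (sel k))
      (fun k => M (sel k)) hrb hNb fun k => (hIAR (sel k)).1
  -- Step 5: apply HT to the diagonal family and defeat its constant
  obtain ⟨c', hc'⟩ := hVS (fun k => r (sel k) + 1) (fun k => F (sel k)) (fun k => e (sel k)) hVP
    (fun k => hhom (sel k)) (fun k => hhyp (sel k))
  set c₀ : ℕ := 2 * c' + 1 with hc₀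
  set k₀ : ℕ := max c₀ (N c₀) with hk₀
  obtain ⟨m, hm, p, A, B, hrep⟩ := hc' k₀
  have hq : H c₀ ≤ H (sel k₀) := hselmax k₀ c₀ (le_max_left _ _) (le_max_right _ _)
  have harith : (Nat.log 2 k₀ + c') ^ c' ≤ H (sel k₀) :=
    (permanentalCones_diag_arith c' (N c₀)).trans hq
  exact hhard (sel k₀) m (hm.trans (Nat.pow_le_pow_right (by norm_num) harith)) p A B hrep

/-- **Crux #5 ≡ crux #3.** The family form and the pencil form of the route's transfer are
equivalent: `HyperbolicVPShadow ↔ HyperbolicDetShadow` (the direction `←` is the proved item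
`DetToVP`, `permanentalCones_detToVP_proof`). [folklore] -/
theorem permanentalCones_hyperbolicVPShadow_iff_hyperbolicDetShadow :
    Summit.ValiantsHypothesis.ValiantsHypothesis.Theses.PermanentalCones.HyperbolicVPShadow ↔
      Summit.ValiantsHypothesis.ValiantsHypothesis.Theses.PermanentalCones.HyperbolicDetShadow :=
  ⟨permanentalCones_hyperbolicDetShadow_of_hyperbolicVPShadow, permanentalCones_detToVP_proof⟩

/-- **The crux ≡ its load-bearing stub.** `HyperbolicVPShadow` is equivalent to the real-spectrum
shadow statement of stub B (`stub_realSpectrumShadow` of line `birth`): combine the equivalence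
with crux #3 and bridge 2 (with the landed stub A). [folklore] -/
theorem permanentalCones_hyperbolicVPShadow_iff_realSpectrumShadow :
    Summit.ValiantsHypothesis.ValiantsHypothesis.Theses.PermanentalCones.HyperbolicVPShadow ↔
      ∃ c : ℕ, ∀ (n N : ℕ) (P : (Fin n → ℝ) →ₗ[ℝ] Matrix (Fin N) (Fin N) ℝ),
        (∀ (x : Fin n → ℝ) (z : ℂ),
          ((P x).map (algebraMap ℝ ℂ) - z • (1 : Matrix (Fin N) (Fin N) ℂ)).det = 0 → z.im = 0) →
        ∃ m ≤ 2 ^ ((Nat.log 2 N + c) ^ c),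
          ∃ (p : ℕ) (A : (Fin n → ℝ) × (Fin p → ℝ) →ₗ[ℝ] Matrix (Fin m) (Fin m) ℝ)
            (B : Matrix (Fin m) (Fin m) ℝ), ∀ x : Fin n → ℝ,
            (∀ τ : ℝ, 0 < τ → (P x + τ • (1 : Matrix (Fin N) (Fin N) ℝ)).det ≠ 0) ↔
              ∃ y : Fin p → ℝ, (A (x, y) + B).PosSemidef :=
  permanentalCones_hyperbolicVPShadow_iff_hyperbolicDetShadow.trans
    (permanentalCones_realSpectrumShadow_iff_hyperbolicDetShadow
      stub_linearRealSpectrumNormalForm).symm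

end Summit.ValiantsHypothesis.ValiantsHypothesis.Theorems
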